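import Literature.Computability.Cryptography.RegevSamplerRegs
import Literature.Computability.QuantumComplexity.QFTStagePlaced
import HarnessLib

/-!
# Regev 2009, Lemma 3.14 in machine form: the Fourier stage on the residue registers

Topic `Computability/Cryptography` (family `pqc`), grouping namespace `Regev2009.SamplerRegs`; sequel of
`RegevSamplerRegs.lean` (the residue blocks `Sblk i : Fin ℓ_R ↪ Fin W` of the sampler's layout, the
prepared labels `lab₀`) and of `QuantumComplexity/QFTStagePlaced.lean` (`QFTStage.stageCircuit_implOn`:
the chain of the transported Fourier blocks implements `multiQFT (S E)` on the clean-input condition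
`QFTStage.P E` up to `n·κ²·qftPhaseErr k`). Regev's last step of Lemma 3.14 (J. ACM 56 (2009), art. 34;
author's version arXiv:2401.03703, p. 20: "apply the quantum Fourier transform on `ℤ_R^n`" to the second
register, `R = 2^{ℓ_R}`, i.e. the `ℓ_R`-qubit QFT on each of the `n` residue registers) is here
INSTANTIATED on the sampler's register layout:

* `qftBlock` — the Fourier block embeddings: data wire `j < ℓ_R` of block `i` IS the residue wire
  `Sblk i j`, every other wire of the Fourier kit goes to the work window above the layout's base
  (`qftBlock_apply_lt`, `qftBlock_apply_ge`, `qftBlock_dataEmb`); `blockDisjoint_qftBlock`;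
* **`S_qftBlock`** — the data registers of these blocks are the residue blocks: `QFTStage.S qftBlock = Sblk`;
* `mem_kitP_of_high_clean` — a content of the Fourier kit's block clean above the data wires satisfies the
  kit's clean-input condition; **`mem_P_qftBlock_of_window_clean`** — hence every label clean on the work
  window lies in `QFTStage.P qftBlock`; `kappa_lab₀_window`, **`kappa_lab₀_mem_P_qftBlock`** — in
  particular the FINAL labels of the ideal classical run on the prepared labels do (the `hPF` hypothesis of
  `QPart.law_bound_of_basis`);
* **`qftStage_implOn_Sblk`** — THE FOURIER STAGE OF THE SAMPLER: the stage circuit implements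
  `multiQFT Sblk` on `QFTStage.P qftBlock` up to `ε_F = n·ℓ_R²·qftPhaseErr k_F` (the `hMF` hypothesis), and
  is unitary (`qftStage_mem_unitaryGroup`).

Everything is proved; definitions have bodies; no named fact is introduced.

## References

* O. Regev, *On lattices, learning with errors, random linear codes, and cryptography*, J. ACM 56
  (2009), art. 34; author's version arXiv:2401.03703: Lemma 3.14 (proof, p. 20) [Regev2009].
* M. A. Nielsen, I. L. Chuang, *Quantum Computation and Quantum Information*, CUP 2010, §5.1 (the
  quantum Fourier transform), §4.5.3 (approximating gates) [NielsenChuang2010].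
-/

noncomputable section

namespace Literature.Computability.Cryptography

namespace Regev2009

namespace SamplerRegs

open Literature.Algebra.EuclideanLattices Literature.Algebra.EuclideanLattices.Regev2009
  Literature.Algebra.EuclideanLattices.Regev2009.QPart Literature.Computability.QuantumComplexity
  Literature.Computability.QuantumComplexity.QFTQubits Literature.Computability.QuantumComplexity.QFTWord
  Literature.Computability.Complexity Literature.LinearAlgebra.Matrix.Berkowitz Peikert2009 Finset _root_.Matrix SamplerArith
  SamplerScale SamplerGeom SamplerWords SamplerWordFns SamplerFormats SamplerQuery CVPOracle SamplerClassical
  SamplerClassical.Layout _root_.Computability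
open scoped Real

variable {W : ℕ} (I : LatticeInstance) {Λ : Layout W I.n} (hΛ : Λ.OK) (kF : ℕ)
  (hroom : Λ.base + I.n * QFTKit.qbsize Λ.ℓR kF ≤ W)

/-! ### The Fourier block embeddings -/

include hΛ in
/-- A residue wire lies below the layout's base. [folklore] -/
theorem fin_S_lt_base (i : Fin I.n) {j : ℕ} (hj : j < Λ.ℓR) : (Λ.fin (Λ.oS + ((i : ℕ) * Λ.ℓR + j)) : ℕ) < Λ.base := by
  have hT := Λ.T_eq
  obtain ⟨-, -, hS', hA', hT'⟩ := offs_eq I Λ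
  have h1 := blk_lt i ⟨j, hj⟩
  exact Layout.fin_lt_base hΛ (by simp only at h1; omega)

/-- **The `i`-th Fourier block**: data wire `j < ℓ_R` of the Fourier kit goes to the residue wire
`Sblk i j`, any other kit wire `q` to the window wire `base + i·qbsize + q`.
[cite: Regev2009, Lemma 3.14 (proof: "the quantum Fourier transform" on the second register)] [cite: NielsenChuang2010, §5.1] -/
def qftBlock (i : Fin I.n) : Fin (QFTKit.qbsize Λ.ℓR kF) ↪ Fin W where
  toFun q := if h : (q : ℕ) < Λ.ℓR then Λ.fin (Λ.oS + ((i : ℕ) * Λ.ℓR + q))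
    else ⟨Λ.base + ((i : ℕ) * QFTKit.qbsize Λ.ℓR kF + q), by have := blk_lt i q; omega⟩
  inj' q q' hqq := by
    by_cases h : (q : ℕ) < Λ.ℓR <;> by_cases h' : (q' : ℕ) < Λ.ℓR
    · simp only [dif_pos h, dif_pos h'] at hqq
      have hT := Λ.T_eq
      obtain ⟨-, -, hS', hA', hT'⟩ := offs_eq I Λ
      have h1 := blk_lt i ⟨q, h⟩; have h2 := blk_lt i ⟨q', h'⟩
      simp only at h1 h2
      have := Layout.fin_inj hΛ (by omega) (by omega) hqq
      exact Fin.ext (by omega)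
    · simp only [dif_pos h, dif_neg h'] at hqq
      have := fin_S_lt_base I hΛ i h
      rw [hqq] at this
      exact absurd this (by simp)
    · simp only [dif_neg h, dif_pos h'] at hqq
      have := fin_S_lt_base I hΛ i h'
      rw [← hqq] at this
      exact absurd this (by simp)
    · simp only [dif_neg h, dif_neg h', Fin.mk.injEq] at hqq
      exact Fin.ext (by omega)

/-- The Fourier block on a data position. [folklore] -/
theorem qftBlock_apply_lt (i : Fin I.n) {q : Fin (QFTKit.qbsize Λ.ℓR kF)} (hq : (q : ℕ) < Λ.ℓR) :
    qftBlock I hΛ kF hroom i q = Λ.fin (Λ.oS + ((i : ℕ) * Λ.ℓR + q)) := by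
  show (if h : (q : ℕ) < Λ.ℓR then Λ.fin (Λ.oS + ((i : ℕ) * Λ.ℓR + q)) else _) = _
  rw [dif_pos hq]

/-- The Fourier block off the data positions: a window wire. [folklore] -/
theorem qftBlock_apply_ge (i : Fin I.n) {q : Fin (QFTKit.qbsize Λ.ℓR kF)} (hq : Λ.ℓR ≤ (q : ℕ)) :
    (qftBlock I hΛ kF hroom i q : ℕ) = Λ.base + ((i : ℕ) * QFTKit.qbsize Λ.ℓR kF + q) := by
  have h : ¬ (q : ℕ) < Λ.ℓR := not_lt.2 hq
  show ((if h : (q : ℕ) < Λ.ℓR then Λ.fin (Λ.oS + ((i : ℕ) * Λ.ℓR + q))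
    else ⟨Λ.base + ((i : ℕ) * QFTKit.qbsize Λ.ℓR kF + q), _⟩ : Fin W) : ℕ) = _
  rw [dif_neg h]

/-- **The data wires of the Fourier block are the residue wires.** [cite: Regev2009, Lemma 3.14 (proof)] -/
theorem qftBlock_dataEmb (i : Fin I.n) (j : Fin Λ.ℓR) : qftBlock I hΛ kF hroom i (QFTKit.dataEmb Λ.ℓR kF j) = Sblk I hΛ i j := by
  have hv := QFTKit.dataEmb_val Λ.ℓR kF j
  rw [qftBlock_apply_lt I hΛ kF hroom i (by rw [hv]; exact j.2), sblk_apply, hv]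

/-- **The data registers of the Fourier blocks are the residue blocks.** [cite: Regev2009, Lemma 3.14 (proof)] -/
theorem S_qftBlock : QFTStage.S (qftBlock I hΛ kF hroom) = Sblk I hΛ := by
  funext i
  ext j
  show ((qftBlock I hΛ kF hroom i (QFTKit.dataEmb Λ.ℓR kF j) : Fin W) : ℕ) = Sblk I hΛ i j
  rw [qftBlock_dataEmb]

/-- **The Fourier blocks are pairwise disjoint.** [folklore] -/
theorem blockDisjoint_qftBlock : BlockDisjoint (qftBlock I hΛ kF hroom) := fun i i' hii => by
  refine Set.disjoint_left.2 ?_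
  rintro w ⟨q, rfl⟩ ⟨q', hq'⟩
  by_cases h : (q : ℕ) < Λ.ℓR <;> by_cases h' : (q' : ℕ) < Λ.ℓR
  · rw [qftBlock_apply_lt I hΛ kF hroom i h, qftBlock_apply_lt I hΛ kF hroom i' h'] at hq'
    have hT := Λ.T_eq
    obtain ⟨-, -, hS', hA', hT'⟩ := offs_eq I Λ
    have h1 := blk_lt i ⟨q, h⟩; have h2 := blk_lt i' ⟨q', h'⟩
    simp only at h1 h2
    have h3 := Layout.fin_inj hΛ (by omega) (by omega) hq'
    have h4 : ((i' : ℕ)) * Λ.ℓR + ((⟨q', h'⟩ : Fin Λ.ℓR) : ℕ) = (i : ℕ) * Λ.ℓR + ((⟨q, h⟩ : Fin Λ.ℓR) : ℕ) := by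
      simp only; omega
    exact hii (blk_inj h4).1.symm
  · have h1 := fin_S_lt_base I hΛ i h
    rw [← qftBlock_apply_lt I hΛ kF hroom i h, ← hq', qftBlock_apply_ge I hΛ kF hroom i' (not_lt.1 h')] at h1
    omega
  · have h1 := fin_S_lt_base I hΛ i' h'
    rw [← qftBlock_apply_lt I hΛ kF hroom i' h', hq', qftBlock_apply_ge I hΛ kF hroom i (not_lt.1 h)] at h1
    omega
  · have e := congrArg Fin.val hq'
    rw [qftBlock_apply_ge I hΛ kF hroom i (not_lt.1 h), qftBlock_apply_ge I hΛ kF hroom i' (not_lt.1 h')] at e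
    have h1 := blk_lt i q; have h2 := blk_lt i' q'
    have h4 : ((i' : ℕ)) * QFTKit.qbsize Λ.ℓR kF + (q' : ℕ) = (i : ℕ) * QFTKit.qbsize Λ.ℓR kF + (q : ℕ) := by omega
    exact hii (blk_inj h4).1.symm

/-! ### The clean-input condition -/

omit hΛ in
/-- **A content of the Fourier kit's block that is clean above the data wires satisfies the kit's
clean-input condition** (the Hadamard, averaging, region and helper wires all lie above the `κ` data
wires). [cite: NielsenChuang2010, §4.5.3] -/
theorem mem_kitP_of_high_clean {κ k : ℕ} (hk : 1 ≤ k) (x : QReg (QFTKit.qbsize κ k))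
    (hx : ∀ q : Fin (QFTKit.qbsize κ k), κ ≤ (q : ℕ) → x q = false) : x ∈ (QFTKit.kit κ k).P := by
  have hlow : ∀ (a : Fin (QFTKit.qbsize κ k)) (ha : (a : ℕ) < κ), a = QFTKit.dataEmb κ k ⟨a, ha⟩ := fun a ha =>
    Fin.ext (by rw [QFTKit.dataEmb_val])
  have key : ∀ a : Fin (QFTKit.qbsize κ k), a ∈ (QFTKit.kit κ k).cr :: (QFTKit.kit κ k).as ++ (QFTKit.kit κ k).region ∨ a ∈ (QFTKit.kit κ k).hs →
      κ ≤ (a : ℕ) := by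
    intro a ha
    by_contra hlt
    rw [not_le] at hlt
    obtain ⟨h1, -, h3, h4⟩ := QFTKit.data_facts κ k ⟨a, hlt⟩
    rw [← hlow a hlt] at h1 h3 h4
    rcases ha with ha | ha
    · rcases List.mem_append.1 ha with ha | ha
      · exact h3 ha
      · exact absurd h1 (not_lt.2 (GadgetKit.region_val (QFTKit.kit_ok κ k hk) a ha))
    · exact h4 ha
  refine ⟨fun a ha => hx a (key a (Or.inl ha)), fun a ha => hx a (key a (Or.inr ha))⟩

/-- **A label clean on the work window lies in the Fourier stage's clean-input condition.**
[cite: Regev2009, Lemma 3.14 (proof)] [cite: NielsenChuang2010, §4.5.3] -/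
theorem mem_P_qftBlock_of_window_clean (hk : 1 ≤ kF) (z : QReg W) (hz : ∀ w : Fin W, Λ.base ≤ (w : ℕ) → z w = false) :
    z ∈ QFTStage.P (qftBlock I hΛ kF hroom) :=
  Set.mem_iInter.2 fun i => mem_kitP_of_high_clean hk _ fun q hq => by
    show z ((qftBlock I hΛ kF hroom i) q) = false
    exact hz _ (by rw [qftBlock_apply_ge I hΛ kF hroom i hq]; omega)

include hΛ in
/-- **The final label of the ideal classical run on a prepared label is clean on the work window.**
[cite: Regev2009, Lemma 3.14 (proof)] -/
theorem kappa_lab₀_window [IsZLattice ℝ I.lattice] (hF : Fits Λ) {t : ℝ} (ht : 0 < t) (r : ℚ) (k : ℕ) (y : List Bool) (e : ℚ)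
    (Fq pad : List Bool) (hFq : Fq.length = Λ.Lq) (huz : (zoneOf Fq ((parOf I, 2 ^ Λ.ℓR), e) pad).length = Λ.L)
    (Yb : Fin I.n → Fin Λ.ℓ → Bool) (w : Fin W) (hw : Λ.base ≤ (w : ℕ)) :
    kappa Λ (answerFn I r k y Λ.kq (I.n * Λ.bc))
        (lab₀ I Λ (2 ^ Λ.ℓR) t (zoneOf Fq ((parOf I, 2 ^ Λ.ℓR), e) pad) (boxPt (DT I (2 ^ Λ.ℓR) t) Yb)) w = false := by
  have hT := Λ.T_eq
  have hR1 : 1 ≤ 2 ^ Λ.ℓR := Nat.two_pow_pos _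
  have hD : DT I (2 ^ Λ.ℓR) t ≠ 0 := (DT_pos I (2 ^ Λ.ℓR) ht).ne'
  have hYlen : (wordY ((parOf I, 2 ^ Λ.ℓR), e).1.1 I.n Λ.ℓ Λ.ℓY (pointsWord Yb)).length = I.n * Λ.ℓY := by
    show (wordY (parOf I) I.n Λ.ℓ Λ.ℓY (pointsWord Yb)).length = _
    rw [wordY_points I Λ.ℓY Yb, length_tableZ]
  have hSlen : (wordS ((parOf I, 2 ^ Λ.ℓR), e).1.1 ((parOf I, 2 ^ Λ.ℓR), e).1.2 I.n Λ.ℓ Λ.ℓR (pointsWord Yb)).length = I.n * Λ.ℓR := by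
    show (wordS (parOf I) (2 ^ Λ.ℓR) I.n Λ.ℓ Λ.ℓR (pointsWord Yb)).length = _
    rw [wordS_points I (2 ^ Λ.ℓR) hR1 Λ.ℓR Yb, CVPOracle.length_table]
  have hzX : ∀ s, s < I.n * Λ.ℓ → lab₀ I Λ (2 ^ Λ.ℓR) t (zoneOf Fq ((parOf I, 2 ^ Λ.ℓR), e) pad) (boxPt (DT I (2 ^ Λ.ℓR) t) Yb) (Λ.fin s) =
      (pointsWord Yb).getD s false := fun s hs => by
    rw [lab₀_X I hΛ _ t _ _ hs, blocksOf_boxPt I hD]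
  obtain ⟨-, -, -, -, h5⟩ := kappa_spec hΛ hF (answerFn I r k y Λ.kq (I.n * Λ.bc)) ((parOf I, 2 ^ Λ.ℓR), e) (pointsWord Yb) Fq pad
    (length_pointsWord Yb) hFq huz hYlen hSlen _ hzX (fun s hs => lab₀_U I hΛ _ t _ _ hs) (fun s hs hs' => lab₀_R I hΛ _ t _ _ hs hs')
    (fun w hw => lab₀_window I hΛ _ t _ _ w hw)
  rw [h5 w (fun s hs h => ?_) (fun s hs hs' h => ?_)]
  · exact lab₀_window I hΛ _ t _ _ w hw
  · have := Layout.fin_lt_base hΛ (i := s) (by omega); rw [← h] at this; omega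
  · have := Layout.fin_lt_base hΛ (i := s) hs'; rw [← h] at this; omega

/-- **The final labels of the ideal run lie in the Fourier stage's clean-input condition** (the `hPF`
hypothesis of `QPart.law_bound_of_basis`). [cite: Regev2009, Lemma 3.14 (proof)] -/
theorem kappa_lab₀_mem_P_qftBlock [IsZLattice ℝ I.lattice] (hF : Fits Λ) (hk : 1 ≤ kF) {t : ℝ} (ht : 0 < t) (r : ℚ) (k : ℕ)
    (y : List Bool) (e : ℚ) (Fq pad : List Bool) (hFq : Fq.length = Λ.Lq) (huz : (zoneOf Fq ((parOf I, 2 ^ Λ.ℓR), e) pad).length = Λ.L)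
    (Yb : Fin I.n → Fin Λ.ℓ → Bool) :
    kappa Λ (answerFn I r k y Λ.kq (I.n * Λ.bc))
        (lab₀ I Λ (2 ^ Λ.ℓR) t (zoneOf Fq ((parOf I, 2 ^ Λ.ℓR), e) pad) (boxPt (DT I (2 ^ Λ.ℓR) t) Yb)) ∈
      QFTStage.P (qftBlock I hΛ kF hroom) :=
  mem_P_qftBlock_of_window_clean I hΛ kF hroom hk _ (kappa_lab₀_window I hΛ hF ht r k y e Fq pad hFq huz Yb)

/-! ### The Fourier stage -/

/-- **Regev 2009, Lemma 3.14 — the Fourier stage of the sampler (machine form).** The chain of the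
transported Fourier blocks implements the `n`-fold `ℓ_R`-qubit QFT of the residue registers,
`multiQFT Sblk`, on `QFTStage.P qftBlock` up to `ε_F = n · ℓ_R² · qftPhaseErr k_F`.
[cite: Regev2009, Lemma 3.14 (proof)] [cite: NielsenChuang2010, §5.1, §4.5.3] -/
theorem qftStage_implOn_Sblk (hk : 1 ≤ kF) :
    ImplOn (QFTStage.P (qftBlock I hΛ kF hroom)) ((QFTStage.stageCircuit (qftBlock I hΛ kF hroom) hk).toMatrix 0)
      (multiQFT (Sblk I hΛ)) (I.n * (Λ.ℓR * Λ.ℓR * qftPhaseErr kF)) := by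
  rw [← S_qftBlock I hΛ kF hroom]
  exact QFTStage.stageCircuit_implOn hk (blockDisjoint_qftBlock I hΛ kF hroom)

/-- The Fourier stage is unitary. [folklore] -/
theorem qftStage_mem_unitaryGroup (hk : 1 ≤ kF) :
    (QFTStage.stageCircuit (qftBlock I hΛ kF hroom) hk).toMatrix 0 ∈ Matrix.unitaryGroup (QReg W) ℂ :=
  QCircuit.toMatrix_mem_unitaryGroup_holds cliffordT_isUnitary_holds 0 _

end SamplerRegs

end Regev2009

end Literature.Computability.Cryptography

end
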